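import Summits.Ventures.CertifiedManyBodySolver.Downfold.EmeryFermiFillingRows
import HarnessLib

/-!
# Generic cell counting on the momentum quadrant `[0, π]²`: Brillouin-zone fractions from flagged grid cells

Venture CertifiedManyBodySolver, cell `pub/hubbard-downfold` (stage S1), seat hubbard-downfold-mod-4; namespace
`Summit.Ventures.CertifiedManyBodySolver.Downfold.Emery`. Everything here is PROVED; no number and no band lives here.
WHAT THIS IS NOT: anything about a material or a model — pure measure theory on the grid `k_i = iπ/K` of
`EmeryFermiFilling` (cells `cellIco / cellIcc`, `exists_gridIndex`).

`EmeryFermiFillingCount` proves the two counting inequalities for the σ three-band occupied set with the band-specific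
cell tests inlined. This file states them ONCE for an ARBITRARY set `S ⊆ [0, π]²` and an arbitrary finite family of
flagged cells, so that every band (the direct one-band Wannier band of `OneBandInPlane`, the four-orbital band, …)
only has to supply the soundness of its own cell tests:

* `quadFrac S = volume(S)/π²` (the per-spin Brillouin-zone fraction of a set in the quadrant), `quadFrac_mono`,
  `quadFrac_nonneg`, `quadFrac_le_one`;
* INNER `card_div_sq_le_quadFrac`: if every flagged half-open cell lies in `S`, then `card/K² ≤ quadFrac S`;
* OUTER `quadFrac_le_card_div_sq`: if every UNflagged closed cell (indices `< K`) misses `S`, then `quadFrac S ≤ card/K²`;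
* `mem_Icc_of_monotone_bracket`: the Fermi-energy bracket from two counts for any monotone filling function.

Source: [folklore] (Lebesgue measure of grid cells; R. E. Moore, Interval Analysis (1966), §4.4 for the subdivision idea).
-/

noncomputable section

namespace Summit.Ventures.CertifiedManyBodySolver.Downfold.Emery

open Real MeasureTheory Set

/-- The momentum quadrant `[0, π]²`. [folklore] -/
def quadrant : Set (ℝ × ℝ) := Icc (0 : ℝ) π ×ˢ Icc (0 : ℝ) π

/-- The per-spin Brillouin-zone FRACTION of a set in the quadrant: `volume(S)/π²`. [folklore] -/
def quadFrac (S : Set (ℝ × ℝ)) : ℝ := (volume S).toReal / π ^ 2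

/-- A subset of the quadrant has measure at most `π²`. [folklore] -/
theorem volume_le_of_subset_quadrant {S : Set (ℝ × ℝ)} (hS : S ⊆ quadrant) :
    volume S ≤ ENNReal.ofReal (π - 0) * ENNReal.ofReal (π - 0) := by
  rw [← volume_Icc_prod_Icc]
  exact measure_mono hS

/-- [folklore] -/
theorem volume_ne_top_of_subset_quadrant {S : Set (ℝ × ℝ)} (hS : S ⊆ quadrant) : volume S ≠ ⊤ :=
  ne_top_of_le_ne_top (ENNReal.mul_ne_top ENNReal.ofReal_ne_top ENNReal.ofReal_ne_top)
    (volume_le_of_subset_quadrant hS)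

/-- `0 ≤ quadFrac`. [folklore] -/
theorem quadFrac_nonneg (S : Set (ℝ × ℝ)) : 0 ≤ quadFrac S := by unfold quadFrac; positivity

/-- `quadFrac S ≤ 1` for `S ⊆ [0, π]²`. [folklore] -/
theorem quadFrac_le_one {S : Set (ℝ × ℝ)} (hS : S ⊆ quadrant) : quadFrac S ≤ 1 := by
  unfold quadFrac
  rw [div_le_one (by positivity)]
  have h := (ENNReal.toReal_le_toReal (volume_ne_top_of_subset_quadrant hS)
    (ENNReal.mul_ne_top ENNReal.ofReal_ne_top ENNReal.ofReal_ne_top)).2 (volume_le_of_subset_quadrant hS)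
  rw [ENNReal.toReal_mul, ENNReal.toReal_ofReal (by linarith [Real.pi_pos])] at h
  nlinarith [h]

/-- `quadFrac` is monotone under inclusion (inside the quadrant). [folklore] -/
theorem quadFrac_mono {S T : Set (ℝ × ℝ)} (hST : S ⊆ T) (hT : T ⊆ quadrant) : quadFrac S ≤ quadFrac T := by
  unfold quadFrac
  exact div_le_div_of_nonneg_right
    (ENNReal.toReal_mono (volume_ne_top_of_subset_quadrant hT) (measure_mono hST)) (by positivity)

/-- **INNER COUNTING.** If every cell of the finite family `F` has its half-open cell `[k_i, k_{i+1}) × [k_j, k_{j+1})`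
inside `S ⊆ [0, π]²`, then `card F / K² ≤ quadFrac S`. [folklore] -/
theorem card_div_sq_le_quadFrac {K : ℕ} (hK : 0 < K) {S : Set (ℝ × ℝ)} (hS : S ⊆ quadrant)
    (F : Finset (ℕ × ℕ)) (hF : ∀ ij ∈ F, cellIco K ij ⊆ S) :
    (F.card : ℝ) / (K : ℝ) ^ 2 ≤ quadFrac S := by
  have hKr : (0 : ℝ) < K := by exact_mod_cast hK
  have hπ := Real.pi_pos
  have hsub : (⋃ ij ∈ F, cellIco K ij) ⊆ S := by
    intro k hk
    simp only [Set.mem_iUnion, exists_prop] at hk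
    obtain ⟨ij, hij, hk⟩ := hk
    exact hF ij hij hk
  have hvol : volume (⋃ ij ∈ F, cellIco K ij) =
      (F.card : ENNReal) * (ENNReal.ofReal (π / K) * ENNReal.ofReal (π / K)) := by
    rw [measure_biUnion_finset (fun ij _ ij' _ hne => cellIco_disjoint K hne)
      (fun ij _ => measurableSet_cellIco K ij)]
    simp only [volume_cellIco hK, Finset.sum_const, nsmul_eq_mul]
  have hle : (F.card : ENNReal) * (ENNReal.ofReal (π / K) * ENNReal.ofReal (π / K)) ≤ volume S :=
    hvol ▸ measure_mono hsub
  have hreal : (F.card : ℝ) * (π / K * (π / K)) ≤ (volume S).toReal := by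
    have := (ENNReal.toReal_le_toReal (by
      exact ENNReal.mul_ne_top (ENNReal.natCast_ne_top _)
        (ENNReal.mul_ne_top ENNReal.ofReal_ne_top ENNReal.ofReal_ne_top))
        (volume_ne_top_of_subset_quadrant hS)).2 hle
    rw [ENNReal.toReal_mul, ENNReal.toReal_mul, ENNReal.toReal_natCast,
      ENNReal.toReal_ofReal (by positivity)] at this
    exact this
  unfold quadFrac
  rw [div_le_div_iff₀ (by positivity) (by positivity)]
  have hKK : (π / K * (π / K)) * (K : ℝ) ^ 2 = π ^ 2 := by field_simp
  calc (F.card : ℝ) * π ^ 2 = (F.card : ℝ) * (π / K * (π / K)) * (K : ℝ) ^ 2 := by rw [mul_assoc, hKK]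
    _ ≤ (volume S).toReal * (K : ℝ) ^ 2 := mul_le_mul_of_nonneg_right hreal (by positivity)

/-- **OUTER COUNTING.** If every closed cell `[k_i, k_{i+1}] × [k_j, k_{j+1}]` with `i, j < K` that is NOT in `F` is
disjoint from `S ⊆ [0, π]²`, then `quadFrac S ≤ card F / K²`. [folklore] -/
theorem quadFrac_le_card_div_sq {K : ℕ} (hK : 0 < K) {S : Set (ℝ × ℝ)} (hS : S ⊆ quadrant)
    (F : Finset (ℕ × ℕ)) (hF : ∀ i j, i < K → j < K → (i, j) ∉ F → Disjoint (cellIcc K (i, j)) S) :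
    quadFrac S ≤ (F.card : ℝ) / (K : ℝ) ^ 2 := by
  have hKr : (0 : ℝ) < K := by exact_mod_cast hK
  have hπ := Real.pi_pos
  have hcov : S ⊆ ⋃ ij ∈ F, cellIcc K ij := by
    rintro ⟨k1, k2⟩ hk
    obtain ⟨⟨h10, h1π⟩, ⟨h20, h2π⟩⟩ := hS hk
    obtain ⟨i, hi, hi1, hi2⟩ := exists_gridIndex hK h10 h1π
    obtain ⟨j, hj, hj1, hj2⟩ := exists_gridIndex hK h20 h2π
    simp only [Set.mem_iUnion, exists_prop]
    have hcell : ((k1, k2) : ℝ × ℝ) ∈ cellIcc K (i, j) := ⟨⟨hi1, hi2⟩, ⟨hj1, hj2⟩⟩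
    refine ⟨(i, j), ?_, hcell⟩
    by_contra hnot
    exact Set.disjoint_left.1 (hF i j hi hj hnot) hcell hk
  have hle : volume S ≤ (F.card : ENNReal) * (ENNReal.ofReal (π / K) * ENNReal.ofReal (π / K)) := by
    calc volume S ≤ volume (⋃ ij ∈ F, cellIcc K ij) := measure_mono hcov
      _ ≤ ∑ ij ∈ F, volume (cellIcc K ij) := measure_biUnion_finset_le F _
      _ = (F.card : ENNReal) * (ENNReal.ofReal (π / K) * ENNReal.ofReal (π / K)) := by
          simp only [volume_cellIcc hK, Finset.sum_const, nsmul_eq_mul]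
  have hreal : (volume S).toReal ≤ (F.card : ℝ) * (π / K * (π / K)) := by
    have hne : (F.card : ENNReal) * (ENNReal.ofReal (π / K) * ENNReal.ofReal (π / K)) ≠ ⊤ :=
      ENNReal.mul_ne_top (ENNReal.natCast_ne_top _)
        (ENNReal.mul_ne_top ENNReal.ofReal_ne_top ENNReal.ofReal_ne_top)
    have := (ENNReal.toReal_le_toReal (volume_ne_top_of_subset_quadrant hS) hne).2 hle
    rw [ENNReal.toReal_mul, ENNReal.toReal_mul, ENNReal.toReal_natCast,
      ENNReal.toReal_ofReal (by positivity)] at this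
    exact this
  unfold quadFrac
  rw [div_le_div_iff₀ (by positivity) (by positivity)]
  have hKK : (π / K * (π / K)) * (K : ℝ) ^ 2 = π ^ 2 := by field_simp
  calc (volume S).toReal * (K : ℝ) ^ 2 ≤ (F.card : ℝ) * (π / K * (π / K)) * (K : ℝ) ^ 2 :=
        mul_le_mul_of_nonneg_right hreal (by positivity)
    _ = (F.card : ℝ) * π ^ 2 := by rw [mul_assoc, hKK]

/-- **THE BRACKET FROM TWO COUNTS** for any monotone function `f` (a filling as a function of energy): if
`f(ε₁) ≤ u < ν₁` and `ν₂ < l ≤ f(ε₂)`, every `ε` with `f(ε) ∈ [ν₁, ν₂]` lies in `[ε₁, ε₂]`. [folklore] -/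
theorem mem_Icc_of_monotone_bracket {f : ℝ → ℝ} (hf : Monotone f) {ε ε₁ ε₂ ν₁ ν₂ u l : ℝ}
    (h₁ : f ε₁ ≤ u) (hu : u < ν₁) (h₂ : l ≤ f ε₂) (hl : ν₂ < l) (hν : f ε ∈ Set.Icc ν₁ ν₂) :
    ε ∈ Set.Icc ε₁ ε₂ := by
  obtain ⟨hlo, hhi⟩ := hν
  constructor
  · by_contra h
    have := hf (le_of_not_ge h)
    linarith
  · by_contra h
    have := hf (le_of_not_ge h)
    linarith

/-- Two counts at the SAME energy enclose the value: `l ≤ f(e) ≤ u` — packaged for tables (e.g. the van Hove filling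
at the saddle-point energy). [folklore] -/
theorem mem_Icc_of_counts {f : ℝ → ℝ} {e l u : ℝ} (hl : l ≤ f e) (hu : f e ≤ u) : f e ∈ Set.Icc l u := ⟨hl, hu⟩

end Summit.Ventures.CertifiedManyBodySolver.Downfold.Emery
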